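import Literature.NumberTheory.DiophantineGeometry.SumOfTwoFifthPowersPerfectPower

/-!
# Venture AbcShadow — SH-25 STATEMENT: `x⁵ + y⁵ = z²³` has no non-trivial primitive solution (signature `(5, 5, 23)`)

HONEST FRAMING. Statement file of the work-bound cell `abc-shadow` (row SH-25 of its census; typer seat `abc-shadow-typ-3`).
This file PROVES NOTHING about the equation: it types the TARGET of the row as a plain `Prop` (`SH25P23`), REUSING the
vocabulary of `Literature/NumberTheory/DiophantineGeometry/SumOfTwoFifthPowersPerfectPower.lean` ([DahmenSiksek2014, §1]:
a solution of `x⁵ + y⁵ = z^l` is *non-trivial* if `xyz ≠ 0` and *primitive* if `x, y, z` are coprime), together with its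
equivalent shape "every primitive solution is one of the six trivial ones `±(0, 1, 1), ±(1, 0, 1), ±(1, −1, 0)`" — the wording
of [Stoll2017, Prop 8.1 / Thm 8.8] — proved equivalent from the Literature classification of trivial solutions.
ADJACENT result (generalized Fermat, signature `(5, 5, p)`), NOT abc: nothing here is a claim on the abc conjecture or on any
summit, and nothing here takes a side on IUT.

In print: [Stoll2017, Thm 8.8] asserts `C'_p(ℚ) = {∞, (1, ±1)}` — hence `SH25 p` — for `7 ≤ p ≤ 53` prime, "assuming GRH when
`p ≥ 23`"; so `p = 23` is GRH-CONDITIONAL in print. The row (`SH25/RowP23.lean`) derives `SH25P23` from the NAMED print inputs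
[St17, Prop 8.5 / Cor 8.7] and [DS14, Prop 3.3] with the GRH clause REPLACED by the cell's certified class-group computation for
`ℚ(2^{1/23})` (certificate fd412faf746f7ef4), entering as a hypothesis stated in Mathlib's own vocabulary.
-/

namespace Summit.Ventures.AbcShadow

open Literature.NumberTheory.DiophantineGeometry

/-- **SH-25 target, one exponent `l`** [cite: Stoll2017, Thm 8.8 ("in particular": x⁵ + y⁵ = z^p has only the trivial coprime
solutions)]: the equation `x⁵ + y⁵ = z^l` has NO non-trivial primitive solution (`x, y` coprime, `xyz ≠ 0`;
`DahmenSiksek2014.IsNontrivialPrimitiveSolution`, cited, not restated). Plain `Prop`; nothing is asserted. -/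
def SH25 (l : ℕ) : Prop :=
  ∀ x y z : ℤ, ¬ DahmenSiksek2014.IsNontrivialPrimitiveSolution l x y z

/-- **SH-25 (census row of the cell `abc-shadow`), `p = 23`** [cite: Stoll2017, Thm 8.8 (p = 23: GRH-conditional in print)]:
`x⁵ + y⁵ = z²³` has no non-trivial primitive solution. This is the TARGET `Prop`; the conditional derivation is `SH25/RowP23.lean`.
ADJACENT, NOT abc. -/
def SH25P23 : Prop :=
  SH25 23

/-- Bookkeeping [cite: Stoll2017, Prop 8.1 (the list of trivial solutions)]: for odd `l`, `SH25 l` is literally "every solution of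
`x⁵ + y⁵ = z^l` in coprime integers is one of `±(0, 1, 1), ±(1, 0, 1), ±(1, −1, 0)`" (proved from
`DahmenSiksek2014.trivial_solutions`). -/
theorem sh25_iff_trivial (l : ℕ) (hl : Odd l) :
    SH25 l ↔ ∀ x y z : ℤ, x ^ 5 + y ^ 5 = z ^ l → IsCoprime x y →
      (x = 0 ∧ y = 1 ∧ z = 1) ∨ (x = 0 ∧ y = -1 ∧ z = -1) ∨ (x = 1 ∧ y = 0 ∧ z = 1) ∨ (x = -1 ∧ y = 0 ∧ z = -1) ∨
        (x = 1 ∧ y = -1 ∧ z = 0) ∨ (x = -1 ∧ y = 1 ∧ z = 0) := by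
  constructor
  · intro h x y z heq hxy
    have h0 : x * y * z = 0 := by
      by_contra hne
      exact h x y z ⟨heq, hxy, hne⟩
    exact DahmenSiksek2014.trivial_solutions hl heq hxy h0
  · rintro h x y z ⟨heq, hxy, hne⟩
    rcases h x y z heq hxy with ⟨rfl, -, -⟩ | ⟨rfl, -, -⟩ | ⟨-, rfl, -⟩ | ⟨-, rfl, -⟩ | ⟨-, -, rfl⟩ | ⟨-, -, rfl⟩ <;>
      simp at hne

/-- `SH25P23` in the shape of [St17, Thm 8.8]'s corollary: the only coprime solutions of `x⁵ + y⁵ = z²³` are the six trivial ones.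
[cite: Stoll2017, Thm 8.8 (p = 23, corollary shape)] -/
theorem sh25P23_iff_trivial :
    SH25P23 ↔ ∀ x y z : ℤ, x ^ 5 + y ^ 5 = z ^ 23 → IsCoprime x y →
      (x = 0 ∧ y = 1 ∧ z = 1) ∨ (x = 0 ∧ y = -1 ∧ z = -1) ∨ (x = 1 ∧ y = 0 ∧ z = 1) ∨ (x = -1 ∧ y = 0 ∧ z = -1) ∨
        (x = 1 ∧ y = -1 ∧ z = 0) ∨ (x = -1 ∧ y = 1 ∧ z = 0) :=
  sh25_iff_trivial 23 (by decide)

end Summit.Ventures.AbcShadow
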